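/-
Copyright (c) 2026. All rights reserved.
Released under Apache 2.0 license as described in the file LICENSE.
Authors: abc-iut cell, wave-2 seat abc-iut-L3-t10 (gen 3; row «LD-REPAIR» (C′): the residual contract of
[SemiAnbd] Thm 3.7 (iii) at a Galois tower — identifications (I1)–(I3) + a per-level branch dictionary with
covering kernels and good conjugator sets).
-/
import Literature.AnabelianGeometry.SemiGraphs.TemperedBranchPairProducerGood
import Literature.AnabelianGeometry.SemiGraphs.TemperedPiLevelDataOfTower
import Literature.AnabelianGeometry.SemiGraphs.TemperedCompactInVerticialOfOneChart
import HarnessLib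

/-!
# [SemiAnbd] Thm 3.7 (iii) for finite `𝔾` from a Galois tower: the residual producer contract

Mochizuki, *Semi-graphs of anabelioids*, Publ. RIMS **42** (2006) [MochizukiSemiAnbd2006], Thm 3.7 (iii),
manuscript pp. 40–41 ("consider the projective system of connected finite étale Galois coverings … `H` acts on
`𝒢_{∞,i}` … this action factors through a finite quotient … Since the semi-graphs `𝔾_j` are all finite …"),
with the author's *Comments* (2020) (6)(b) and Remark 2.2.1 p. 24 / Definition 2.2 (i) p. 23 for the per-level
dictionary.

PROOF-ONLY ASSEMBLY, no new mathematics, no definitions (cell row «LD-REPAIR» (C), seat abc-iut-L3-t10 gen 3). For Galois level data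
`D` (abc-iut-L3-t9's `GaloisLevelData`: tower `S n`, `D.temperedPi = lim_n Aut(𝒢_{∞,S n})`), a chart `c` with
a continuous `ρ : c.G → D.temperedPi`, connected finite levels and a FINITE `𝔾` (cell ruling φ2),
abc-iut-L3-t6's `GaloisLevelData.finiteLevelDataOfTower` supplies every tree / finite-level field of
`FiniteLevelData` and takes as inputs the identifications (I1) `fix`, (I2) `stab`, (I3) `edge` and (I4′)
`stabBranchPair'`.  Here (I4′) is DISCHARGED from a per-level branch dictionary at the finite levels
`𝔾_{S n} = (D.S n).orbitGraph` in a compact overgroup `Q ⊇ c.G` with an antitone family of open normal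
subgroups `N n` meeting in `1` — print's covering kernels `ker (π̂₁(𝒢) → Gal(𝒢_n/𝒢))` — and good conjugator
sets, by `stabBranchPair'_of_coveringDictionary'` (`TemperedBranchPairProducerGood.lean`; the un-primed
`compactInVerticial_of_towerDictionary` of `TemperedCompactInVerticialOfTowerDictionary.lean` is the earlier
∀γ-form):

* `GaloisLevelData.compactInVerticial_of_towerDictionary'` — from `D`, (I1)–(I3) and the dictionary data /
  obligations (DB′), (DI′), (DN′) for good conjugators at the orbit graphs (`finiteLevelDataOfTower` fed with
  `stabBranchPair'_of_coveringDictionary'`): BOTH conjuncts of Thm 3.7 (iii)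
  (`CompactInVerticial`) at EVERY chart `c'` of `𝒢` and every compact `C ≤ c'.G`, for finite `𝔾` satisfying
  `Thm37Hypotheses` (chart transport `FiniteLevelData.nonempty_of_nonempty`, then
  `FiniteLevelData.compactInVerticial` with Thm 3.7 (i)/(ii) `verticialInjective_holds` / `verticialDistinct_holds`
  by name).

So the residual producer contract of Thm 3.7 (iii) for finite `𝔾` is exactly the hypothesis list of
`compactInVerticial_of_towerDictionary'` for ONE chart of each such `𝒢`: the tower (in the tree: `galoisLevelData h36`),
(I1)–(I3), and {`Q` compact Hausdorff receiving `c.G` injectively and acting on the levels through `levelAct`,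
the kernels `N n`, reference embeddings `ψ_v`, representatives `rep`, GOOD conjugator sets `good n w` (print:
`{γ | γ · w₀ = w}`; nonempty, closed, decreasing — cell finding F-t11g2-1 / O-LD-2: the branch obligations must not
be asked for every (DV)-admissible conjugator), and (DB′), (DI′), (DN′) for good conjugators}.  Why the covering kernels and
not the graph-action kernels of abc-iut-L3-t11's `LevelDictionary`: see `TemperedBranchPairProducerCov.lean`
(for an edgeless one-vertex `𝒢` every orbit graph is a point, so no `LevelDictionary` over orbit graphs exists
when `Π_v ≠ 1`).  Nothing here takes a side on [IUTchIII] Cor. 3.12; typed ≠ proved for the inputs.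
-/

namespace Literature.AnabelianGeometry.SemiGraphs

namespace ProfiniteSemiGraph

namespace GaloisLevelData

open CategoryTheory Topology
open scoped Pointwise

universe u

variable {𝒢 : ProfiniteSemiGraph.{u}} (D : GaloisLevelData 𝒢) (h𝒢 : 𝒢.IsCountable)
  (c : TemperedPiChart 𝒢) (ρ : c.G →* D.temperedPi h𝒢)
  (hconn : ∀ (n : ℕ) (p q : (D.S n).Point), (D.S n).SameComponent p q)
  [Finite 𝒢.graph.Vertex] [Finite 𝒢.graph.Edge] (hfin : ∀ n, (D.S n).IsFinite)

include hfin in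
/-- **Thm. 3.7 (iii) for finite `𝔾` from a Galois tower, (I1)–(I3), and a per-level branch dictionary with
covering kernels** — the residual producer contract in one statement: under `Thm37Hypotheses`, the data
(tower, (I1)–(I3), covering dictionary) for ONE chart `c` yield both conjuncts of
`CompactInVerticial` at EVERY chart `c'` of `𝒢` and every compact `C ≤ c'.G` (abc-iut-L3-t6's
`finiteLevelDataOfTower` with (I4′) := `stabBranchPair'_of_coveringDictionary'` at the orbit graphs; chart
transport `FiniteLevelData.nonempty_of_nonempty`; then
`FiniteLevelData.compactInVerticial` with Thm. 3.7 (i) `verticialInjective_holds` and (ii)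
`verticialDistinct_holds`). [cite: MochizukiSemiAnbd2006, Thm 3.7(iii) pp.40-41] -/
theorem compactInVerticial_of_towerDictionary' (h37 : 𝒢.Thm37Hypotheses) (hρ : Continuous ρ)
    (fix : ∀ (v : 𝒢.graph.Vertex) (H : Subgroup c.G), H ∈ verticialSubgroups c v →
      ∃ x : ∀ n, (D.tree n).Vertex, (∀ ⦃i j : ℕ⦄ (h : i ≤ j), (D.treeTrans h).vertexMap (x j) = x i) ∧
        ∀ g ∈ H, ∀ n, (D.treeAct h𝒢 n (ρ g)).hom.vertexMap (x n) = x n)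
    (stab : ∀ x : ∀ n, (D.tree n).Vertex,
      (∀ ⦃i j : ℕ⦄ (h : i ≤ j), (D.treeTrans h).vertexMap (x j) = x i) →
        ∃ (v : 𝒢.graph.Vertex) (H : Subgroup c.G), H ∈ verticialSubgroups c v ∧
          ∀ g : c.G, (∀ n, (D.treeAct h𝒢 n (ρ g)).hom.vertexMap (x n) = x n) → g ∈ H)
    (edge : ∀ (j₁ : ℕ) (ε : ∀ j : {j : ℕ // j₁ ≤ j}, (D.tree j.1).Edge),
      (∀ ⦃i j : {j : ℕ // j₁ ≤ j}⦄ (h : i.1 ≤ j.1), (D.treeTrans h).edgeMap (ε j) = ε i) →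
        ∃ (e : 𝒢.graph.Edge) (L : Subgroup c.G), L ∈ edgeLikeSubgroups c e ∧
          (∀ j, (D.treeProj j.1).edgeMap (ε j) = e) ∧
          ∀ g : c.G, (∀ j, (D.treeAct h𝒢 j.1 (ρ g)).hom.edgeMap (ε j) = ε j ∧
            ∀ b : (D.tree j.1).Branch, (D.tree j.1).edgeOf b = ε j →
              (D.treeAct h𝒢 j.1 (ρ g)).hom.branchMap b = b) → g ∈ L)
    (Q : Type u) [Group Q] [TopologicalSpace Q] [IsTopologicalGroup Q] [CompactSpace Q] [T2Space Q]
    (ιQ : c.G →* Q) (hι : Function.Injective ιQ)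
    (qAct : ∀ n, Q →* Aut (D.S n).orbitGraph)
    (hqAct : ∀ (n : ℕ) (g : c.G), qAct n (ιQ g) = D.levelAct h𝒢 hconn n (ρ g))
    (N : ℕ → Subgroup Q) (hNn : ∀ n, (N n).Normal) (hNo : ∀ n, IsOpen (N n : Set Q))
    (hNanti : ∀ ⦃i j : ℕ⦄, i ≤ j → N j ≤ N i) (hNbot : ∀ q : Q, (∀ n, q ∈ N n) → q = 1)
    (ψ : ∀ v : 𝒢.graph.Vertex, 𝒢.Gv v →* Q) (hψi : ∀ v, Function.Injective (ψ v))
    (hψc : ∀ v, Continuous (ψ v))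
    (rep : ∀ (n : ℕ) (_ : (D.S n).orbitGraph.Vertex) (v : 𝒢.graph.Vertex) (_ : Q)
      (_ : (D.S n).orbitGraph.Branch), 𝒢.Gv v)
    -- the good conjugator sets (print: `{γ | γ · w₀ = w}`)
    (good : ∀ n, (D.S n).orbitGraph.Vertex → Set Q)
    (good_nonempty : ∀ (n : ℕ) (w : (D.S n).orbitGraph.Vertex), (good n w).Nonempty)
    (good_isClosed : ∀ (n : ℕ) (w : (D.S n).orbitGraph.Vertex), IsClosed (good n w))
    (good_anti : ∀ ⦃i j : ℕ⦄ (h : i ≤ j) (w : (D.S j).orbitGraph.Vertex),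
      good j w ⊆ good i ((D.levelTrans h).vertexMap w))
    -- the three single-level branch obligations, for good conjugators only
    (DB : ∀ (n : ℕ) (w : (D.S n).orbitGraph.Vertex) (v : 𝒢.graph.Vertex)
      (_ : (D.S n).orbitGraphProj.vertexMap w = v) (γ : Q), γ ∈ good n w →
      ∀ (β : (D.S n).orbitGraph.Branch) (_ : (D.S n).orbitGraph.abuts β = some w) (b : 𝒢.graph.Branch)
        (_ : (D.S n).orbitGraphProj.branchMap β = b) (hb : 𝒢.graph.abuts b = some v),
        ∀ q : Q, ((qAct n q).hom.vertexMap w = w ∧ (qAct n q).hom.branchMap β = β) ↔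
          q ∈ (((𝒢.branchSubgroup b v hb).map (MulAut.conj (rep n w v γ β)).toMonoidHom).map (ψ v)).map
            (MulAut.conj γ).toMonoidHom ⊔ N n)
    (DI : ∀ (n : ℕ) (w : (D.S n).orbitGraph.Vertex) (v : 𝒢.graph.Vertex)
      (_ : (D.S n).orbitGraphProj.vertexMap w = v) (γ : Q), γ ∈ good n w →
      ∀ (β β' : (D.S n).orbitGraph.Branch), (D.S n).orbitGraph.abuts β = some w →
        (D.S n).orbitGraph.abuts β' = some w →
        ∀ (b : 𝒢.graph.Branch) (hb : 𝒢.graph.abuts b = some v),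
        (D.S n).orbitGraphProj.branchMap β = b → (D.S n).orbitGraphProj.branchMap β' = b → β ≠ β' →
        rep n w v γ β' ∉ (((N n).comap ((MulAut.conj γ).toMonoidHom.comp (ψ v)) : Subgroup (𝒢.Gv v)) :
          Set (𝒢.Gv v)) * {rep n w v γ β} * (𝒢.branchSubgroup b v hb : Set (𝒢.Gv v)))
    (DN : ∀ ⦃i j : ℕ⦄ (h : i ≤ j) (w : (D.S j).orbitGraph.Vertex) (v : 𝒢.graph.Vertex)
      (_ : (D.S j).orbitGraphProj.vertexMap w = v) (γ : Q), γ ∈ good j w →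
      ∀ (β : (D.S j).orbitGraph.Branch), (D.S j).orbitGraph.abuts β = some w → ∀ (b : 𝒢.graph.Branch)
        (hb : 𝒢.graph.abuts b = some v), (D.S j).orbitGraphProj.branchMap β = b →
        rep j w v γ β ∈ (((N i).comap ((MulAut.conj γ).toMonoidHom.comp (ψ v)) : Subgroup (𝒢.Gv v)) :
          Set (𝒢.Gv v)) * {rep i ((D.levelTrans h).vertexMap w) v γ ((D.levelTrans h).branchMap β)} *
            (𝒢.branchSubgroup b v hb : Set (𝒢.Gv v)))
    (c' : TemperedPiChart 𝒢) (C : Subgroup c'.G) (hC : IsCompact (C : Set c'.G)) :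
    (∃ (v : 𝒢.graph.Vertex) (H : Subgroup c'.G), H ∈ verticialSubgroups c' v ∧ C ≤ H) ∧
      (C ≠ ⊥ → ∀ (v₁ v₂ : 𝒢.graph.Vertex) (H₁ H₂ : Subgroup c'.G), H₁ ∈ verticialSubgroups c' v₁ →
        H₂ ∈ verticialSubgroups c' v₂ → H₁ ≠ H₂ → C ≤ H₁ → C ≤ H₂ →
          (∀ (v₃ : 𝒢.graph.Vertex) (H₃ : Subgroup c'.G), H₃ ∈ verticialSubgroups c' v₃ → C ≤ H₃ →
              H₃ = H₁ ∨ H₃ = H₂) ∧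
          ∃ (e : 𝒢.graph.Edge) (L : Subgroup c'.G), 𝒢.graph.IsClosedEdge e ∧
            L ∈ edgeLikeSubgroups c' e ∧ C ≤ L) := by
  -- abc-iut-L3-t6's assembly at the tower, with (I4′) supplied by the covering dictionary
  obtain ⟨D'⟩ := FiniteLevelData.nonempty_of_nonempty
    ⟨D.finiteLevelDataOfTower h𝒢 c ρ hconn hfin hρ fix stab edge
      (stabBranchPair'_of_coveringDictionary' c (fun n => (D.S n).orbitGraph)
        (fun n => (D.levelAct h𝒢 hconn n).comp ρ) (fun _ _ h => D.levelTrans h)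
        (fun n => (D.S n).orbitGraphProj) (fun _ _ h => D.levelTrans_proj h) Q ιQ hι qAct hqAct N hNn hNo
        hNanti hNbot ψ hψi hψc rep good good_nonempty good_isClosed good_anti DB DI DN)⟩ c'
  exact FiniteLevelData.compactInVerticial D' verticialDistinct_holds h37
    (fun v => (verticialInjective_holds 𝒢 h37 c' v).1) C hC

end GaloisLevelData

end ProfiniteSemiGraph

end Literature.AnabelianGeometry.SemiGraphs
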